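import Literature.AlgebraicGeometry.Frobenioids.UnitWiseFrobeniusArrows
import HarnessLib

/-!
# Frobenioids I, Corollary 2.6 (unit-wise Frobenius functors), part 3: property (d) and the statement

Mochizuki, *The geometry of Frobenioids I: the general theory*, Kyushu J. Math. **62** (2008)
293–400, §2, Corollary 2.6 (d) and its proof, kurims text pp. 50–51
[cite: MochizukiFrdI2008, Cor. 2.6 p.50]: "(d) If `C` is of perfect type, then `Ψ` is an equivalence
of categories.  If `d = 1` or `C` is of isotropic and unit-trivial type, then `Ψ` is isomorphic to
the identity functor."

* perfect type: the naive Frobenius functor is an equivalence (Prop. 2.1 (iii) — the named statement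
  `NaiveFrobeniusEquivalenceOfPerfect F d` of `NaiveFrobeniusFunctor.lean`, taken here as a
  hypothesis), hence so is its lift `Ψ₁ : C → C(d)` (`isEquivalence_naiveFrobeniusCd`) and
  `Ψ = Ψ₁ ⋙ Ψ_ul⁻¹`;
* `d = 1`, or isotropic and unit-trivial type: then `Ψ₁ ≅ Ψ_ul` (`naiveFrobeniusCdIso…`), so
  `Ψ ≅ Ψ_ul ⋙ Ψ_ul⁻¹ ≅ 𝟭`.
Assembly: `unitWiseFrobeniusExists_of_naiveEquivalence : NaiveFrobeniusEquivalenceOfPerfect F d →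
UnitWiseFrobeniusExists F d` (CONDITIONAL on Prop. 2.1 (iii), which is proved separately).

Provenance: typed/proved by abc-iut-L6-t9 (prover-abc-iut-L6-t9-g0-0; staged HOME/staging/L1/L6-t9/,
MANIFEST.txt, session ended 2026-08-25T23:52Z inviting any seat to file verbatim); filed verbatim by
abc-iut-w5-d248 as filer-of-record (L1-lead ruling R82 (4), 2026-08-26T00:16:47Z) after re-verification
against the current tree (changes: `def cdIsoMk` restated as the theorem `exists_cdIso` so that the file is
proof-only, fully-qualified closing types where applicable, and this note).
-/

noncomputable section

namespace Literature.AlgebraicGeometry.Frobenioids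

open CategoryTheory Opposite

universe w v v' u u'

namespace PreFrobenioid

variable {D : Type u} [Category.{v} D] {Φ : Dᵒᵖ ⥤ CommMonCat.{w}}
  {C : Type u'} [Category.{v'} C] {F : C ⥤ ElemFrobenioid Φ}

/-- An isomorphism of `C` is an arrow of `C(d)` (its zero divisor is `0 ∈ d · Φ`).
[cite: MochizukiFrdI2008, Def. 2.4(iii) p.48] -/
theorem divIn_of_isIso (hP : IsPreFrobenioid Φ F) (δ : Φ ⟶ Φ) {X Y : C} (f : X ⟶ Y) [IsIso f] :
    divIn F δ f :=
  ⟨1, by rw [map_one]; exact (isIsometry_of_isIso F hP f).symm⟩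

/-- An isomorphism of `C` yields an isomorphism of `C(d)` with the same underlying arrows (stated as an
existence so that this file stays proof-only; L6-t9's staged version packaged it as `def cdIsoMk`).
[cite: MochizukiFrdI2008, Def. 2.4(iii) p.48] -/
theorem exists_cdIso (hP : IsPreFrobenioid Φ F) (δ : Φ ⟶ Φ) {X Y : C} (f : X ≅ Y) :
    ∃ i : (⟨X⟩ : Cd F δ) ≅ ⟨Y⟩, i.hom.hom = f.hom ∧ i.inv.hom = f.inv :=
  ⟨{ hom := ⟨f.hom, divIn_of_isIso hP δ f.hom⟩
     inv := ⟨f.inv, divIn_of_isIso hP δ f.inv⟩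
     hom_inv_id := InducedWideCategory.Hom.ext f.hom_inv_id
     inv_hom_id := InducedWideCategory.Hom.ext f.inv_hom_id }, rfl, rfl⟩

section Lift

variable {d : ℕ+} (ch : FrobeniusChoice F d) (h : HasFrobeniusLifts F d)

/-- If the naive Frobenius functor is an equivalence, so is its lift `Ψ₁ : C → C(d)` (the inclusion
`C(d) ⊆ C` is faithful and contains the isomorphisms). [cite: MochizukiFrdI2008, Cor. 2.6 p.51] -/
theorem isEquivalence_naiveFrobeniusCd (hP : IsPreFrobenioid Φ F) [(naiveFrobenius ch h).IsEquivalence] :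
    (naiveFrobeniusCd ch h).IsEquivalence := by
  haveI : (naiveFrobeniusCd ch h).Faithful := ⟨fun {A B} φ ψ hφψ =>
    (naiveFrobenius ch h).map_injective (congrArg InducedWideCategory.Hom.hom hφψ)⟩
  haveI : (naiveFrobeniusCd ch h).Full := ⟨fun {A B} g =>
    ⟨(naiveFrobenius ch h).preimage g.1,
      InducedWideCategory.Hom.ext ((naiveFrobenius ch h).map_preimage g.1)⟩⟩
  haveI : (naiveFrobeniusCd ch h).EssSurj := ⟨fun X =>
    ⟨(naiveFrobenius ch h).objPreimage X.obj,
      (exists_cdIso hP _ ((naiveFrobenius ch h).objObjPreimageIso X.obj)).nonempty⟩⟩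
  exact {}

end Lift

namespace CharacteristicSplitting

variable (hF : IsFrobenioid F) (τ : CharacteristicSplitting F) (hmt : IsOfType (IsMetricallyTrivial F))
  (haa : IsOfType (IsAutAmple F)) (hnorm : IsOfType (IsFrobeniusNormalized F)) (d : ℕ+)
  (ch : FrobeniusChoice F d)

include hF τ hmt haa hnorm d ch

/-! ### (d): perfect type -/

/-- **Cor. 2.6 (d)**, first sentence, from Prop. 2.1 (iii): if the naive Frobenius functor of degree
`d` is an equivalence then so is `Ψ = Ψ₁ ⋙ Ψ_ul⁻¹`. [cite: MochizukiFrdI2008, Cor. 2.6 p.51] -/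
theorem isEquivalence_unitWiseFrobenius
    [(naiveFrobenius ch (hasFrobeniusLifts hF d)).IsEquivalence] :
    (unitWiseFrobenius hF τ hmt haa hnorm d ch).IsEquivalence := by
  letI := isEquivalence_unitLinear hF τ hmt haa hnorm d
  haveI := isEquivalence_naiveFrobeniusCd ch (hasFrobeniusLifts hF d) hF.isPreFrobenioid
  exact Functor.isEquivalence_trans _ _

/-! ### (d): `Ψ ≅ 𝟭` when `Ψ_ul` intertwines the chosen Frobenius morphisms -/

/-- If `ζ_A ; Ψ_ul(φ) = φ ; ζ_B` for base-isomorphisms... more precisely: if for every object `A` an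
isomorphism `e_A : A' ≅ A` is given with `α_A ; e_A ; Ψ_ul(φ) = φ ; α_B ; e_B` for all `φ`, then
`Ψ_ul ≅ Ψ₁` and hence `Ψ = Ψ₁ ⋙ Ψ_ul⁻¹ ≅ 𝟭`. [cite: MochizukiFrdI2008, Cor. 2.6 p.51] -/
theorem nonempty_iso_id_of_intertwine (e : ∀ A : C, ch.obj A ≅ A)
    (he : ∀ {A B : C} (φ : A ⟶ B), ch.hom A ≫ (e A).hom ≫ unitLinearMap hF τ hmt haa (powEnd Φ d) hnorm φ =
      φ ≫ ch.hom B ≫ (e B).hom) : Nonempty ((unitWiseFrobenius hF τ hmt haa hnorm d ch) ≅ 𝟭 C) := by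
  letI := isEquivalence_unitLinear hF τ hmt haa hnorm d
  have hP := hF.isPreFrobenioid
  have hl := hasFrobeniusLifts hF d
  -- `Ψ₁ ≅ Ψ_ul` through the `e_A` (as isomorphisms of `C(d)` with the same underlying arrows)
  choose i hi₁ _hi₂ using fun A => exists_cdIso hP (powEnd Φ d) (e A)
  let N : naiveFrobeniusCd ch hl ≅ (unitLinearFrobeniusData hF τ hmt haa (powEnd Φ d) hnorm).functor :=
    NatIso.ofComponents (fun A => i A) (by
      intro A B φ
      apply InducedWideCategory.Hom.ext
      show ch.lift hl φ ≫ (i B).hom.hom = (i A).hom.hom ≫ unitLinearMap hF τ hmt haa (powEnd Φ d) hnorm φ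
      rw [hi₁ B, hi₁ A]
      have hu : ch.lift hl φ = (e A).hom ≫ unitLinearMap hF τ hmt haa (powEnd Φ d) hnorm φ ≫ (e B).inv :=
        (ch.lift_unique hl φ _ (by
          rw [← Category.assoc, ← Category.assoc, Category.assoc (ch.hom A), he, Category.assoc,
            Category.assoc, (e B).hom_inv_id, Category.comp_id])).symm
      rw [hu, Category.assoc, Category.assoc, (e B).inv_hom_id, Category.comp_id])
  exact ⟨Functor.isoWhiskerRight N (unitLinearFrobeniusData hF τ hmt haa (powEnd Φ d) hnorm).functor.inv ≪≫
    (unitLinearFrobeniusData hF τ hmt haa (powEnd Φ d) hnorm).functor.asEquivalence.unitIso.symm⟩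

/-- **Cor. 2.6 (d)**, `d = 1`: the chosen `α_A` are isomorphisms (morphisms of Frobenius type of degree
`1`, Prop. 1.4 (iii)) and `Ψ_ul = id` on arrows (`β₁^1 = β₁`), so `Ψ ≅ 𝟭`.
[cite: MochizukiFrdI2008, Cor. 2.6 p.51] -/
theorem nonempty_iso_id_of_eq_one (hd : d = 1) : Nonempty ((unitWiseFrobenius hF τ hmt haa hnorm d ch) ≅ 𝟭 C) := by
  have hP := hF.isPreFrobenioid
  have hiso : ∀ A : C, IsIso (ch.hom A) := fun A =>
    isIso_of_isLBInvertible_of_isPreStep F hF (ch.hom A) (ch.isFrobeniusType A).1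
      ⟨by show degFr F (ch.hom A) = 1; rw [ch.degFr_eq A, hd], (ch.isFrobeniusType A).2⟩
  -- for `d = 1`, `Ψ_ul` is the identity on every arrow
  have hid : ∀ {A B : C} (φ : A ⟶ B), unitLinearMap hF τ hmt haa (powEnd Φ d) hnorm φ = φ := by
    intro A B φ
    obtain ⟨A₂, x, β, y, hx, -, hy, -, hfac⟩ := exists_isometric_factorization hF hmt haa φ
    obtain ⟨t, ht, u, hu, hβ⟩ := exists_liftedTau_split hF τ β
    rw [← hfac, unitLinearMap_eq_of_factorization hF τ hmt haa _ hnorm hx β hy,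
      unitLinearPow_eq hF τ hmt haa _ hu ht hβ, tauPow_eq_pow hF τ hmt haa d ht, hd, PNat.one_coe, pow_one,
      ← hβ]
  refine nonempty_iso_id_of_intertwine hF τ hmt haa hnorm d ch (fun A => (@asIso _ _ _ _ (ch.hom A) (hiso A)).symm)
    fun {A B} φ => ?_
  rw [hid, Iso.symm_hom, Iso.symm_hom, @asIso_inv _ _ _ _ _ (hiso A), @asIso_inv _ _ _ _ _ (hiso B),
    @IsIso.hom_inv_id_assoc _ _ _ _ _ (hiso A), @IsIso.hom_inv_id _ _ _ _ _ (hiso B), Category.comp_id]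

omit hF τ hmt haa hnorm d ch in
/-- In a Frobenioid of unit-trivial type, a unit of `O^▷(A)` is `1`. [cite: MochizukiFrdI2008, Def. 1.2(iv) p.23] -/
theorem eq_one_of_isUnit_of_isUnitTrivial {A : C} (hut : IsUnitTrivial F A) {v : endSubmonoid F A}
    (hv : IsUnit v) : v = 1 := by
  obtain ⟨α, hα, hαv⟩ := (isUnit_endSubmonoid_iff F v).mp hv
  dsimp only at hαv
  apply Subtype.ext
  rw [← hαv, hut α hα]
  rfl

/-- **Cor. 2.6 (d)**, isotropic and unit-trivial type: then `ζ_A(d) ; Ψ_ul(φ) = φ ; ζ_B(d)` for the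
Frobenius sections (every object is Frobenius-trivial by Prop. 2.5 (ii); the units `v` of the
`ζ`-conjugate formula are trivial and `Ψ_A(β) = β^d`), so `Ψ ≅ 𝟭`.
[cite: MochizukiFrdI2008, Cor. 2.6 p.51] -/
theorem nonempty_iso_id_of_isUnitTrivial (histr : IsOfIsotropicType F) (hut : IsOfType (IsUnitTrivial F)) :
    Nonempty ((unitWiseFrobenius hF τ hmt haa hnorm d ch) ≅ 𝟭 C) := by
  have hP := hF.isPreFrobenioid
  -- Frobenius sections everywhere, and `e_A : A' ≅ A` with `α_A ; e_A = ζ_A(d)`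
  have hft : ∀ A : C, IsFrobeniusTrivial F A := fun A =>
    (isFrobeniusTrivial_istr_iff hF ⟨A, histr A⟩).mp (isOfType_isFrobeniusTrivial_istr hF hmt ⟨A, histr A⟩)
  choose ζ hζ using hft
  have he : ∀ A : C, ∃ e : ch.obj A ≅ A, ch.hom A ≫ e.hom = (ζ A d : A ⟶ A) := fun A =>
    hF.ii_unique (ch.hom A) (ζ A d : A ⟶ A) (ch.isFrobeniusType A) (hζ A d).2.2
      ((ch.degFr_eq A).trans (hζ A d).1.symm)
  choose e hee using he
  refine nonempty_iso_id_of_intertwine hF τ hmt haa hnorm d ch e fun {A B} φ => ?_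
  rw [reassoc_of% (hee A), hee B]
  -- normal form `φ = ζ_A(n) ; β ; α` (absorbing the unit into `β`)
  obtain ⟨z, β₀, α, hzb, hzf, hα, hfac⟩ := exists_normalForm hF hmt haa (histr A) φ
  obtain ⟨v₀, hv₀, hzv₀⟩ := exists_unit_of_isFrobeniusType_degFr_eq hF (hζ A (degFr F z)).2.1
    (hζ A (degFr F z)).2.2 hzb hzf (hζ A (degFr F z)).1
  set n := degFr F z
  let β : endSubmonoid F A := β₀ * v₀
  have hfac' : (ζ A n : A ⟶ A) ≫ (β.1 : A ⟶ A) ≫ α = φ := by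
    rw [← hfac, hzv₀, Submonoid.coe_mul, End.mul_def]; simp only [Category.assoc]
  obtain ⟨⟨-, hαi⟩, -⟩ := hF.iv_b α hα
  obtain ⟨v, hv, hconj⟩ := exists_zeta_conjugate hF hnorm d (ζ A) (hζ A) n β hα (hζ B d).2.1
    (hζ B d).2.2 (hζ B d).1
  have hv1 : v = 1 := eq_one_of_isUnit_of_isUnitTrivial (hut A) hv
  -- `Ψ_A(β) = β^d` (no units)
  obtain ⟨t, ht, u, hu, hβut⟩ := exists_liftedTau_split hF τ β
  have hu1 : u = 1 := eq_one_of_isUnit_of_isUnitTrivial (hut A) hu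
  have hΨβ : unitLinearPow hF τ hmt haa (powEnd Φ d) A β = β ^ (d : ℕ) := by
    rw [unitLinearPow_eq hF τ hmt haa _ hu ht hβut, tauPow_eq_pow hF τ hmt haa d ht, hβut, hu1, one_mul,
      one_mul]
  rw [← hfac', unitLinearMap_eq_of_factorization hF τ hmt haa _ hnorm (hζ A n).2.2.1.2 β hαi, hΨβ, hconj,
    hv1, one_mul]

/-! ### Corollary 2.6 -/

/-- **Cor. 2.6** (all of (a)–(d)) for the functor `Ψ := Ψ₂ ∘ Ψ₁` built from the Frobenius choice `ch`,
CONDITIONAL on Prop. 2.1 (iii) (`NaiveFrobeniusEquivalenceOfPerfect F d`) for the perfect-type clause.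
[cite: MochizukiFrdI2008, Cor. 2.6 p.50] -/
theorem unitWiseFrobenius_spec (h21 : NaiveFrobeniusEquivalenceOfPerfect F d) :
    OneCommutes (unitWiseFrobenius hF τ hmt haa hnorm d ch) F F (𝟭 (ElemFrobenioid Φ)) ∧
    (∀ A : C, IsIsotropic F A → Nonempty ((unitWiseFrobenius hF τ hmt haa hnorm d ch).obj A ≅ A)) ∧
    (∀ {A B : C} (φ : A ⟶ B), IsIsotropic F A → IsIsotropic F B →
      (IsFrobeniusType F φ ∨ IsPreStep F φ ∨ IsPullbackMorphism F φ) →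
        IsAbstractlyEquivalent ((unitWiseFrobenius hF τ hmt haa hnorm d ch).map φ) φ) ∧
    (∀ A : C, IsIsotropic F A → ∃ e : (unitWiseFrobenius hF τ hmt haa hnorm d ch).obj A ≅ A, ∀ u ∈ unitsSubgroup F A,
      e.inv ≫ (unitWiseFrobenius hF τ hmt haa hnorm d ch).map u.hom ≫ e.hom = (u ^ (d : ℕ)).hom) ∧
    (IsOfPerfectType F → (unitWiseFrobenius hF τ hmt haa hnorm d ch).IsEquivalence) ∧
    ((d = 1 ∨ (IsOfIsotropicType F ∧ IsOfType (IsUnitTrivial F))) →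
      Nonempty ((unitWiseFrobenius hF τ hmt haa hnorm d ch) ≅ 𝟭 C)) := by
  refine ⟨unitWiseFrobenius_oneCommutes hF τ hmt haa hnorm d ch,
    fun A hA => ⟨(unitWiseFrobenius_units hF τ hmt haa hnorm d ch hA).choose⟩,
    fun φ hA hB hφ => unitWiseFrobenius_arrows hF τ hmt haa hnorm d ch φ hA hB hφ,
    fun A hA => unitWiseFrobenius_units hF τ hmt haa hnorm d ch hA, fun hperf => ?_, fun hd => ?_⟩
  · haveI := h21 hF hperf ch (hasFrobeniusLifts hF d)
    exact isEquivalence_unitWiseFrobenius hF τ hmt haa hnorm d ch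
  · rcases hd with hd | ⟨histr, hut⟩
    · exact nonempty_iso_id_of_eq_one hF τ hmt haa hnorm d ch hd
    · exact nonempty_iso_id_of_isUnitTrivial hF τ hmt haa hnorm d ch histr hut

end CharacteristicSplitting

/-- **Cor. 2.6** (unit-wise Frobenius functor): the named statement `UnitWiseFrobeniusExists F d`,
CONDITIONAL on Prop. 2.1 (iii) in the form `NaiveFrobeniusEquivalenceOfPerfect F d` (used only for
the perfect-type clause of (d)). [cite: MochizukiFrdI2008, Cor. 2.6 p.50] -/
theorem unitWiseFrobeniusExists_of_naiveEquivalence (d : ℕ+) (h21 : NaiveFrobeniusEquivalenceOfPerfect F d) :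
    UnitWiseFrobeniusExists F d := by
  intro τ hF hnorm hmt haa
  obtain ⟨ch⟩ := nonempty_frobeniusChoice F hF d
  exact ⟨CharacteristicSplitting.unitWiseFrobenius hF τ hmt haa hnorm d ch,
    CharacteristicSplitting.unitWiseFrobenius_spec hF τ hmt haa hnorm d ch h21⟩

end PreFrobenioid

end Literature.AlgebraicGeometry.Frobenioids
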